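/-
COR-CM (cell pub-hodgecm2, stage 2 of the Hodge ladder) — Δ2 BRIDGE, RE-KEY (c-S.1) layer L5, the (d) PIECES BY VALUE at the SHARED
`ι₁`-presented tail under the GEOMETRIC-PIN instance `algebraMap L ℂ = conj ∘ ι₁` (WALL-BREAKER 3 ∕ S-e, variant V-b of pub-hodgecm2/INBOX
l.≈11790).  Seat prover-pub-hodgecm2-d2bridge-wb-3-g0-0.  THEOREMS ONLY (kernel lane): no definition, no named fact, no instance, no section
`variable` carrying a named Prop, no `sorry`; nothing landed is edited or restated; OUTSIDE the frozen port manifest.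
FRAMING: HC_CM is NOT proved; «Δ2 BRIDGE CLOSED» is NOT claimed; hLiu = READING r8; HELD pending the orientation re-key.
-/
import Summits.HodgeConjecture.CorCM.D2Bridge.HcmPiecesAtPin
import Summits.HodgeConjecture.CorCM.D2Bridge.ConjugateTail
import Summits.HodgeConjecture.CorCM.D2Bridge.HcmS1PinJunctionConj
import HarnessLib

set_option autoImplicit false

/-!
# Δ2 bridge, pieces pin (d) for the RE-KEYED dictionary: J-record at the shared `ι₁`-presented tail, instance `ῑ₁ = conj ∘ ι₁`

[Liu2021] Y. Liu, *Fourier–Jacobi cycles and arithmetic relative trace formula*, Camb. J. Math. **9** (2021) = arXiv:2102.11518.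

✔ `nonempty_hcmPieces_atJRecordPin` (`HcmPiecesAtPin.lean`, d2bridge-prove-3) composes the pieces `HcmPieces` from the J-record
(`map43RecordAtPin J …`, d2bridge-prove-2), the S3∕S4 junction and the S1 junction ✔ `exists_dLiu_of_objOne ιg` — the last one forcing the
complexifying instance to EQUAL the presentation embedding `ιg` of the one-object rest.  Under the orientation verdict (MIS-KEY ∕ (c-S), T-SIGN =
MIRROR) the J value lives at the instance `ῑ₁ := conj ∘ ι₁` (✔ `ComponentAlbanesePin`, `hι : algebraMap ∘ c = ι₁`) while the SHARED tail of the
pin signatures stays `ι₁`-PRESENTED (`restTailOne (AlgHom.id ℚ L) ι₁ …`).  THIS FILE is prove-3's composition with that ONE swap: the S1 step is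
✔ `nonempty_hcmPieces_ofTower_of_isReflexOfTypeG_at (ιP := ι₁) (ιQ := ῑ₁)` (`ConjugateTail.lean`: the chosen Def. 4.5 (2) datum transported
field by field along ✔ `Def45.eta_starRingEnd_comp`, then ✔ `exists_liuCMRecord_of_cmDatum ῑ₁`), the eigen-law currency being
✔ `baseChange_hOneAlgHom_of_lineModuleOne_inst` (`HcmS1PinJunctionConj.lean`, wb-2; = `…_at` of `ConjugateTailCurrency.lean`).  The admissibility input becomes the ONE
implication `hadm′ : ∀ d, d.IsReflexOfTypeG ῑ₁ Φ_μ → adm i d` — `fun _ hd => hΦ ▸ hd` for a dictionary keyed `adm i := (·).IsReflexOfTypeG ῑ₁ (Φ i)`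
(the re-keyed pin `liuDictionaryPin'`, `Φ i := typeOfLine (line i)`; `nonempty_hcmPieces_atRekeyedTower`).  At the LITERAL pin (`adm` keyed `ι₁`)
`hadm′` is NOT available (✔ `OrientationReflexConj.not_forall_isReflexOfTypeG_starRingEnd_comp_imp`).

* `nonempty_hcmPieces_atJRecordPin_conjInst` — rest `HT.restOne (AlgHom.id ℚ L) ι₁ …`, `H := Tower …`;
* `nonempty_hcmPieces_atUniformRest_conjInst` — rest `U.rest (restTailOne (AlgHom.id ℚ L) ι₁ …)` (the SOCKET's `R i` shape), `H := (ofTower …).H` (`rfl` re-typing);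
* `nonempty_hcmPieces_atRekeyedTower` — the same at a tower dictionary keyed `adm i := (·).IsReflexOfTypeG ῑ₁ (Φ i)`, `hadm′` DISCHARGED from `Φ_μ = Φ i`.

Displayed inputs (each with a tree value): `hinst : algebraMap = ῑ₁` (J's instance), `J` (✔ `nonempty_componentAlbanesePinTotal`), `hΓ`
(✔ `ComponentAlbaneseLevelLaw`), `Dμ` ([Liu2021] Prop. 4.6 (1), ✔ `nonempty_obj_restOfCharDeltaPrime h21`), `τ' ∕ hτ'` (= `ῑ₁ ∈ Φ_μ`, the re-keyed `PhiMu′ i`),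
`hK`.  Nothing about Liu's objects is asserted.  HC_CM is NOT proved; «Δ2 BRIDGE CLOSED» is NOT claimed.

## References
* [Liu2021] Thm. 4.18 (1) (FJcycle.tex l. 2239) with proof, map (4.2)/(4.3) (l. 2247–2253); Rem. 4.17; Lem. 2.4 (1) (l. 1210–1228); Def. 4.5 (1)–(2)
  (l. 1939–1951); Def. 4.3 (2) (l. 1919); Prop. 4.6 (1) (l. 1969).
* [Shimura1998] §7.1 Prop. 7, §8.3 Prop. 28.
-/

noncomputable section

open scoped TensorProduct
open CategoryTheory NumberField Function
open Literature.AlgebraicGeometry.Motives (AbelianVariety bettiCohomology)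
open Literature.AlgebraicGeometry.HodgeTheory
open Literature.AlgebraicGeometry.ShimuraVarieties.UnitaryCanonicalModel (exists_recordSystem)
open Literature.NumberTheory.Automorphic Literature.NumberTheory.Automorphic.Liu2021 Literature.NumberTheory.Automorphic.Liu2021.AppendixC
open Literature.NumberTheory.Automorphic.Liu2021.AppendixC.RestOne
open Literature.NumberTheory.Automorphic.PicardCM
open Literature.NumberTheory.Transcendental (Arapura2012_Cor_15_4_6)
open HodgeCM HodgeCM.Model HodgeCM.Model.LevelTranslate HodgeCM.Model.TowerLevel HodgeCM.Model.TowerCarrier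
open Summit.HodgeConjecture.CorCM.D2Bridge.TowerRational

namespace Summit.HodgeConjecture.CorCM.D2Bridge

section CompositionsConjInst

open Literature.AlgebraicGeometry.Motives (SchemeOver)
open HodgeCM.Literature.Theta.LiuAlbaneseModuleDatum.D2Bridge (HcmPieces)

variable {L : HodgeCM.CMField} [IsGalois ℚ (L : Type)] {ι₁ : L →+* ℂ}
variable {V : HodgeCM.HermSpace3 L ι₁} {Φ : Literature.AlgebraicGeometry.Motives.CMType L} {isotropicAt : ℕ → Prop}
variable (Char : Type) (Adm : Char → Type) (Ω : (i : Char) → Adm i → Type)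
  [∀ i a, AddCommGroup (Ω i a)] [∀ i a, Module ℂ (Ω i a)] [∀ i a, Module (adelicAlgebra V) (Ω i a)]
  [∀ i a, IsScalarTower ℂ (adelicAlgebra V) (Ω i a)] (PhiMu : Char → Prop) (adm : Char → LiuCMSide → Prop)
variable {μ : Literature.NumberTheory.Automorphic.IdeleClassGroup L →ₜ* Circle}
  (hμ : Literature.NumberTheory.Automorphic.IdeleClassGroup.IsConjugateSymplectic L μ)
  (hw : Literature.NumberTheory.Automorphic.IdeleClassGroup.HasWeight L μ 1) (Car : Def45.Carriers L μ)
  (Eps : Type) (epsOf : L → Eps) (Chi : Type) (omega : Eps → Chi → Type)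
  [∀ ε χ, AddCommGroup (omega ε χ)] [∀ ε χ, Module ℂ (omega ε χ)]

set_option synthInstance.maxHeartbeats 400000 in
set_option maxHeartbeats 1600000 in
/-- **THE PIECES AT THE J-RECORD PIN — shared `ι₁`-presented tail, instance `ῑ₁ = conj ∘ ι₁`** ([Liu2021] Thm. 4.18 (1), Rem. 4.17,
Lem. 2.4 (1), Def. 4.5 (2)): ✔ `nonempty_hcmPieces_atJRecordPin` with the S1 step replaced by ✔ `nonempty_hcmPieces_ofTower_of_isReflexOfTypeG_at
(ιP := ι₁) (ιQ := conj ∘ ι₁)` (the `η_μ`-invariance ✔ `Def45.eta_starRingEnd_comp` discharging `heta`) at the record's OWN eigenvector `M.α` (currency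
✔ `baseChange_hOneAlgHom_of_lineModuleOne_inst`).  Displayed inputs: `hinst : algebraMap L ℂ = conj ∘ ι₁`, `J ∕ hΓ`, `Dμ : ObjOne (AlgHom.id ℚ L) ι₁ …` (the SHARED
presentation), `τ' ∕ hτ'`, `hK`, and `hadm′ : ∀ d, d.IsReflexOfTypeG (conj ∘ ι₁) Φ_μ → adm i d` (the RE-KEYED admissibility; `fun _ hd => hd` at `liuDictionaryPin'`).
HC_CM is NOT proved; «Δ2 BRIDGE CLOSED» is NOT claimed.
[cite: Liu2021, Thm. 4.18 (1) (FJcycle.tex l. 2239), Rem. 4.17 (l. 2226–2228), proof of Thm. 4.18 map (4.2)/(4.3) (l. 2247–2253), Lem. 2.4 (1) (l. 1210–1228), Def. 4.5 (1)–(2) (l. 1939–1951), Prop. 4.6 (1) (l. 1969)]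
[cite: Shimura1998, §7.1 Proposition 7 and §8.3 Prop. 28] -/
theorem nonempty_hcmPieces_atJRecordPin_conjInst {hHD : exists_isReal_hodgeModel} {hI : hodgePQ_independent_of_hodgeModel}
    {h₁ : BallQuotientUniformised} {h₃ : CMAbelianVarietyRealised} {hA : Arapura2012_Cor_15_4_6} (h : exists_recordSystem)
    (C : Sec42Data (Model.honestP5Of h ⟨L.K⟩ ι₁ ⟨V.Hm, V.isHermitian, V.signature_ι₁, V.posDef_of_ne⟩ Φ) isotropicAt)
    (HT : C.HeckeTranslates)
    (rho : ∀ ε χ, Representation ℂ C.G (omega ε χ)) [Algebra (L : Type) ℂ]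
    (hinst : ∀ x : L, algebraMap (L : Type) ℂ x = ((starRingEnd ℂ).comp ι₁) x)
    (J : ComponentAlbanese hHD hI (ballQuotientUniformisedDatum_of h₁) h₃ hA V h Φ C HT)
    (hΓ : ∀ K₁ : C5.SmallLevel C.S.K₀, ((J.Γof K₁).K : Subgroup ↥V.adelicFin) = (K₁.1 : Subgroup C.G))
    (Dμ : ObjOne (AlgHom.id ℚ (L : Type)) ι₁ hμ hw Car) (τ' : L →+* ℂ) (hτ' : τ' ∈ hμ.cmType.1) (i : Char) (K : HodgeCM.Level V)
    (hK : K ≤ Level.capThree (V := V) (C.S.K₀.1 : Subgroup ↥V.adelicFin) C.S.K₀.2.1)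
    (hadm' : ∀ d : LiuCMSide, d.IsReflexOfTypeG ((starRingEnd ℂ).comp ι₁) hμ.cmType → adm i d) :
    Nonempty (HcmPieces.{0, 1, 0} (toThm418Data C (HT.restOne (AlgHom.id ℚ (L : Type)) ι₁ hμ hw Car Eps epsOf Chi omega rho))
      (map43RecordAtPin J (AlgHom.id ℚ (L : Type)) ι₁ hμ hw Car Eps epsOf Chi omega rho Dμ τ' hτ')
      (Tower hHD hI (ballQuotientUniformisedDatum_of h₁) h₃ hA V)
      (jHPin J (AlgHom.id ℚ (L : Type)) ι₁ hμ hw Car Eps epsOf Chi omega rho Dμ τ' hτ') K.K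
      ((picardCMUniverse hHD hI h₁ h₃).CohC ((picardCMUniverse hHD hI h₁ h₃).pms L ι₁ V K) 1)
      (resTotal hHD hI (ballQuotientUniformisedDatum_of h₁) h₃ hA K)
      ((LiuDictionary.ofTower hHD hI h₁ h₃ hA V Char Adm Ω PhiMu adm).cmClasses K i)) := by
  have e : J.Γof (C.levelOf (K.K : Subgroup ↥V.adelicFin)) = K := J.Γof_levelOf_eq_of_K_eq hK hΓ
  have ht := J.transCond_one_of_Γof_eq e
  exact nonempty_hcmPieces_ofTower_of_isReflexOfTypeG_at V Char Adm Ω PhiMu adm Φ ι₁ ((starRingEnd ℂ).comp ι₁) hμ hw Car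
    Eps epsOf Chi omega h C rho (HT.rhoΩOne (AlgHom.id ℚ (L : Type)) ι₁ hμ hw Car) hinst
    (Def45.eta_starRingEnd_comp (AlgHom.id ℚ (L : Type)) ι₁ hμ)
    (map43RecordAtPin J (AlgHom.id ℚ (L : Type)) ι₁ hμ hw Car Eps epsOf Chi omega rho Dμ τ' hτ')
    (levelwisePin J (AlgHom.id ℚ (L : Type)) ι₁ hμ hw Car Dμ)
    (map43RecordAtPin_P J (AlgHom.id ℚ (L : Type)) ι₁ hμ hw Car Eps epsOf Chi omega rho Dμ τ' hτ')
    (jHPin J (AlgHom.id ℚ (L : Type)) ι₁ hμ hw Car Eps epsOf Chi omega rho Dμ τ' hτ') i K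
    (BettiUniverse.pull
      (transMorU (ballQuotientUniformisedDatum_of h₁) h₃ hHD hI hA (1 : ↥(Urat V)).2 K
          ((J.Γof (C.levelOf (K.K : Subgroup ↥V.adelicFin))).conj 1 (J.belowConjThree _)) ht ≫
        J.alb (C.levelOf (K.K : Subgroup ↥V.adelicFin)) 1) 1)
    (J.resTotal_ι_transKQ_tmul (AlgHom.id ℚ (L : Type)) ι₁ hμ hw Car Eps epsOf Chi omega rho Dμ τ' hτ' e ht)
    (map43RecordAtPin J (AlgHom.id ℚ (L : Type)) ι₁ hμ hw Car Eps epsOf Chi omega rho Dμ τ' hτ').α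
    (baseChange_hOneAlgHom_of_lineModuleOne_inst ι₁ hμ hw Car Dμ
      (map43RecordAtPin J (AlgHom.id ℚ (L : Type)) ι₁ hμ hw Car Eps epsOf Chi omega rho Dμ τ' hτ').α
      (map43RecordAtPin J (AlgHom.id ℚ (L : Type)) ι₁ hμ hw Car Eps epsOf Chi omega rho Dμ τ' hτ').α_mem)
    (map43RecordAtPin J (AlgHom.id ℚ (L : Type)) ι₁ hμ hw Car Eps epsOf Chi omega rho Dμ τ' hτ').α_ne
    (fun f => transMorU (ballQuotientUniformisedDatum_of h₁) h₃ hHD hI hA (1 : ↥(Urat V)).2 K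
          ((J.Γof (C.levelOf (K.K : Subgroup ↥V.adelicFin))).conj 1 (J.belowConjThree _)) ht ≫
        J.alb (C.levelOf (K.K : Subgroup ↥V.adelicFin)) 1 ≫ (AbelianVariety.Hom.baseChange ℂ f).hom.hom.hom)
    (fun f => J.rj_comp_phiStarQ_baseChange (AlgHom.id ℚ (L : Type)) ι₁ hμ hw Car Dμ ht f _)
    hμ.cmType rfl hadm'

set_option synthInstance.maxHeartbeats 400000 in
set_option maxHeartbeats 3200000 in
/-- **THE SAME AT THE DECISION #8 ∕ SOCKET TYPE `U.rest (restTailOne (AlgHom.id ℚ L) ι₁ …)`** — μ-uniform Weil carriers `U : UniformOmega C`, tower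
`(ofTower …).H` — re-typed along ✔ `UniformOmega.restOne_eq_rest` and `ofTower_H` (both `rfl`); record spelled as the BODY `map43RecordAtPin … U.Eps U.epsOf
U.Chi (U.omega μ hμ) (U.rho μ hμ) …` (prove-3's spelling rule).  HC_CM is NOT proved; «Δ2 BRIDGE CLOSED» is NOT claimed.
[cite: Liu2021, Thm. 4.18 (1) (FJcycle.tex l. 2239), proof of Thm. 4.18 (l. 2247–2253), Def. 4.11, Def. 4.16, Lem. 2.4 (1) (l. 1210–1228), Def. 4.5 (2) (l. 1944–1951)] -/
theorem nonempty_hcmPieces_atUniformRest_conjInst {hHD : exists_isReal_hodgeModel} {hI : hodgePQ_independent_of_hodgeModel}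
    {h₁ : BallQuotientUniformised} {h₃ : CMAbelianVarietyRealised} {hA : Arapura2012_Cor_15_4_6} (h : exists_recordSystem)
    (C : Sec42Data (Model.honestP5Of h ⟨L.K⟩ ι₁ ⟨V.Hm, V.isHermitian, V.signature_ι₁, V.posDef_of_ne⟩ Φ) isotropicAt)
    (HT : C.HeckeTranslates) [Algebra (L : Type) ℂ]
    (hinst : ∀ x : L, algebraMap (L : Type) ℂ x = ((starRingEnd ℂ).comp ι₁) x) (U : UniformOmega C)
    (J : ComponentAlbanese hHD hI (ballQuotientUniformisedDatum_of h₁) h₃ hA V h Φ C HT)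
    (hΓ : ∀ K₁ : C5.SmallLevel C.S.K₀, ((J.Γof K₁).K : Subgroup ↥V.adelicFin) = (K₁.1 : Subgroup C.G))
    (Dμ : ObjOne (AlgHom.id ℚ (L : Type)) ι₁ hμ hw Car) (τ' : L →+* ℂ) (hτ' : τ' ∈ hμ.cmType.1) (i : Char) (K : HodgeCM.Level V)
    (hK : K ≤ Level.capThree (V := V) (C.S.K₀.1 : Subgroup ↥V.adelicFin) C.S.K₀.2.1)
    (hadm' : ∀ d : LiuCMSide, d.IsReflexOfTypeG ((starRingEnd ℂ).comp ι₁) hμ.cmType → adm i d) :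
    Nonempty (HcmPieces.{0, 1, 0}
      (toThm418Data C (U.rest (restTailOne (AlgHom.id ℚ (L : Type)) ι₁ hμ hw Car (HT.rhoΩOne (AlgHom.id ℚ (L : Type)) ι₁ hμ hw Car))))
      (map43RecordAtPin J (AlgHom.id ℚ (L : Type)) ι₁ hμ hw Car U.Eps U.epsOf U.Chi (U.omega μ hμ) (U.rho μ hμ) Dμ τ' hτ')
      (LiuDictionary.ofTower hHD hI h₁ h₃ hA V Char Adm Ω PhiMu adm).H
      (jHPin J (AlgHom.id ℚ (L : Type)) ι₁ hμ hw Car U.Eps U.epsOf U.Chi (U.omega μ hμ) (U.rho μ hμ) Dμ τ' hτ') K.K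
      ((picardCMUniverse hHD hI h₁ h₃).CohC ((picardCMUniverse hHD hI h₁ h₃).pms L ι₁ V K) 1)
      (resTotal hHD hI (ballQuotientUniformisedDatum_of h₁) h₃ hA K)
      ((LiuDictionary.ofTower hHD hI h₁ h₃ hA V Char Adm Ω PhiMu adm).cmClasses K i)) :=
  nonempty_hcmPieces_atJRecordPin_conjInst Char Adm Ω PhiMu adm hμ hw Car U.Eps U.epsOf U.Chi (U.omega μ hμ) h C HT (U.rho μ hμ) hinst
    J hΓ Dμ τ' hτ' i K hK hadm'

set_option synthInstance.maxHeartbeats 400000 in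
set_option maxHeartbeats 3200000 in
/-- **THE SAME AT A TOWER DICTIONARY KEYED AT THE GEOMETRIC PIN** `adm i dd := dd.IsReflexOfTypeG (conj ∘ ι₁) (Φc i)` (the shape of the re-keyed
`liuDictionaryPin'`, `Φc i := typeOfLine (line i)`), with the admissibility input DISCHARGED from the X3-Char identification `hΦ : Φ_μ = Φc i`
(✔ `cmType_eq_lineType_of_deltaPos` at the pin).  HC_CM is NOT proved; «Δ2 BRIDGE CLOSED» is NOT claimed.
[cite: Liu2021, Thm. 4.18 (1) (FJcycle.tex l. 2239), proof of Thm. 4.18 (l. 2247–2253), Def. 4.3 (2) (l. 1919), Def. 4.5 (2) (l. 1944–1951)] -/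
theorem nonempty_hcmPieces_atRekeyedTower {hHD : exists_isReal_hodgeModel} {hI : hodgePQ_independent_of_hodgeModel}
    {h₁ : BallQuotientUniformised} {h₃ : CMAbelianVarietyRealised} {hA : Arapura2012_Cor_15_4_6} (h : exists_recordSystem)
    (C : Sec42Data (Model.honestP5Of h ⟨L.K⟩ ι₁ ⟨V.Hm, V.isHermitian, V.signature_ι₁, V.posDef_of_ne⟩ Φ) isotropicAt)
    (HT : C.HeckeTranslates) [Algebra (L : Type) ℂ]
    (hinst : ∀ x : L, algebraMap (L : Type) ℂ x = ((starRingEnd ℂ).comp ι₁) x) (U : UniformOmega C)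
    (Φc : Char → Literature.AlgebraicGeometry.Motives.CMType L)
    (J : ComponentAlbanese hHD hI (ballQuotientUniformisedDatum_of h₁) h₃ hA V h Φ C HT)
    (hΓ : ∀ K₁ : C5.SmallLevel C.S.K₀, ((J.Γof K₁).K : Subgroup ↥V.adelicFin) = (K₁.1 : Subgroup C.G))
    (Dμ : ObjOne (AlgHom.id ℚ (L : Type)) ι₁ hμ hw Car) (τ' : L →+* ℂ) (hτ' : τ' ∈ hμ.cmType.1) (i : Char) (K : HodgeCM.Level V)
    (hK : K ≤ Level.capThree (V := V) (C.S.K₀.1 : Subgroup ↥V.adelicFin) C.S.K₀.2.1)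
    (hΦ : hμ.cmType = Φc i) :
    Nonempty (HcmPieces.{0, 1, 0}
      (toThm418Data C (U.rest (restTailOne (AlgHom.id ℚ (L : Type)) ι₁ hμ hw Car (HT.rhoΩOne (AlgHom.id ℚ (L : Type)) ι₁ hμ hw Car))))
      (map43RecordAtPin J (AlgHom.id ℚ (L : Type)) ι₁ hμ hw Car U.Eps U.epsOf U.Chi (U.omega μ hμ) (U.rho μ hμ) Dμ τ' hτ')
      (LiuDictionary.ofTower hHD hI h₁ h₃ hA V Char Adm Ω PhiMu
        (fun i dd => dd.IsReflexOfTypeG ((starRingEnd ℂ).comp ι₁) (Φc i))).H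
      (jHPin J (AlgHom.id ℚ (L : Type)) ι₁ hμ hw Car U.Eps U.epsOf U.Chi (U.omega μ hμ) (U.rho μ hμ) Dμ τ' hτ') K.K
      ((picardCMUniverse hHD hI h₁ h₃).CohC ((picardCMUniverse hHD hI h₁ h₃).pms L ι₁ V K) 1)
      (resTotal hHD hI (ballQuotientUniformisedDatum_of h₁) h₃ hA K)
      ((LiuDictionary.ofTower hHD hI h₁ h₃ hA V Char Adm Ω PhiMu
        (fun i dd => dd.IsReflexOfTypeG ((starRingEnd ℂ).comp ι₁) (Φc i))).cmClasses K i)) :=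
  nonempty_hcmPieces_atUniformRest_conjInst Char Adm Ω PhiMu (fun i dd => dd.IsReflexOfTypeG ((starRingEnd ℂ).comp ι₁) (Φc i))
    hμ hw Car h C HT hinst U J hΓ Dμ τ' hτ' i K hK
    (fun d hd => show d.IsReflexOfTypeG ((starRingEnd ℂ).comp ι₁) (Φc i) from hΦ ▸ hd)

end CompositionsConjInst

end Summit.HodgeConjecture.CorCM.D2Bridge

end
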